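import Summits.ResolutionOfSingularities.ResolutionOfSingularities.Theses.PAlteration
import Literature.Barriers.ResolutionOfSingularities.InseparableBaseChangeResolution
import Literature.AlgebraicGeometry.Resolution.ProjectiveSpaceRegular

/-!
# `PicoverToRadicialBottom` — negative lemmas: refutation cost and the load-bearing hypothesis

Support (negative) lemmas for crux `stmt-ResolutionOfSingularities-0556`
(`Summit.ResolutionOfSingularities.ResolutionOfSingularities.Theses.PAlteration.PicoverToRadicialBottom`:
for every prime `p`, PICover_p — finite radicial covers of regular varieties over fields of
characteristic `p` have resolutions — implies RadicialBottom_p — if `g : X'' → X` is finite,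
universally injective and surjective between integral schemes, `X` separated of finite type over a
field of characteristic `p`, and `X''` has a resolution, then `X` has a resolution), filed by the
standing disprover (cdisprove gen 1; work file `Cruxes/PicoverToRadicialBottom/Disproof.lean`,
whose `PicoverAt p` / `RadicialBottomAt p` are the two displayed families). This file declares NO
definition; every variant is written out inline.

* `not_resolutionOfSingularities_of_not_picoverToRadicialBottom`,
  `exists_picover_of_not_picoverToRadicialBottom` — REFUTATION COST: a proof of `¬ crux` refutes
  the summit `ResolutionOfSingularities` (the consequent is an instance of `ResolutionInChar p`,
  an integral scheme being reduced) AND proves the route's open rank-2 crux PICover_p at some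
  prime. No integral separated finite-type scheme over a field without a resolution is known in
  any characteristic, so no unconditional kill is available; the crux is summit-implied.
* `radicialBottom_false_without_isIntegral_at` — the hypothesis `IsIntegral X` is LOAD-BEARING at
  every prime: with it dropped, `X = Spec 𝔽_p[ε]`, `X'' = Spec 𝔽_p`, `g` the closed immersion
  `ε ↦ 0` (finite; universally injective, being a monomorphism; surjective onto the one-point
  space), `X''` regular hence its own resolution, and `Spec 𝔽_p[ε]` has no resolution
  (`Literature.Barriers.ResolutionOfSingularities.not_hasResolution_Spec_dualNumber`: a one-point
  scheme with a resolution is reduced). This is the scheme-level form, for this crux's exact binder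
  list, of block (2) of `Literature.Barriers.ResolutionOfSingularities.FrobeniusTwistResolution`
  ("HasResolution does not transfer along finite universal homeomorphisms of non-reduced schemes").
* `picoverToRadicialBottom_without_isIntegral_iff` — crux-shaped corollary: with `IsIntegral X`
  dropped from the consequent, the crux becomes EQUIVALENT to `∀ p prime, ¬ PICover_p`, the
  negation of the route's own rank-2 crux `Picover` at every prime.
* `radicialBottom_without_hasResolution_iff_summit` — with `HasResolution X''` dropped (take
  `g = 𝟙 X`) the consequent family over all primes is EQUIVALENT to the summit (reduced → integral
  by the route's proved `DescentReducedToIntegral_holds`): the hypothesis is what separates the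
  crux from the assembly.
* `isIntegral_of_isReduced_of_surjective` — refinement: given `IsIntegral X''` and
  `Function.Surjective g.base`, `IsIntegral X` is implied by `IsReduced X` (continuous image of an
  irreducible space); only generic reducedness of `X` is load-bearing.

## Sources
* Q. Liu, *Algebraic Geometry and Arithmetic Curves*, OUP 2002, Example 3.2.12 / Prop. 3.2.7
  (the one-point mechanism, via the tree's barrier file). Folklore otherwise.
* M. Temkin, *Inseparable local uniformization*, J. Algebra 373 (2013), Rem. 1.3.5 (i) (the
  Frobenius argument for the crux and its caveat `[k : k^p] < ∞`), context only.
-/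

noncomputable section

open CategoryTheory AlgebraicGeometry TopologicalSpace
open Literature.AlgebraicGeometry.Resolution
open Literature.Barriers.ResolutionOfSingularities
open Summit.ResolutionOfSingularities.ResolutionOfSingularities.Theses.PAlteration

set_option linter.dupNamespace false

namespace Summit.ResolutionOfSingularities.ResolutionOfSingularities.Theorems.PicoverToRadicialBottom.Negative

/-! ## Refutation cost -/

/-- **A refutation of the crux refutes the summit**: if `PicoverToRadicialBottom` fails then
`ResolutionOfSingularities` fails (at the offending prime the consequent is an instance of
`ResolutionInChar p`, an integral scheme being reduced). [folklore] -/
theorem not_resolutionOfSingularities_of_not_picoverToRadicialBottom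
    (h : ¬ PicoverToRadicialBottom) : ¬ _root_.ResolutionOfSingularities := by
  intro hS
  apply h
  intro p hp _ k _ _ X X'' f g hsep hft hqc hX _ _ _ _ _
  exact hS p hp k X f hsep hft hqc inferInstance

/-- **… and proves PICover_p at some prime**: if `PicoverToRadicialBottom` fails then at some
prime `p` the route's rank-2 crux (the antecedent, `Picover` at `p`) holds. [folklore] -/
theorem exists_picover_of_not_picoverToRadicialBottom (h : ¬ PicoverToRadicialBottom) :
    ∃ p : ℕ, p.Prime ∧
      ∀ (k : Type) [Field k] [CharP k p] (Y X : Scheme.{0}) (f : Y ⟶ Spec (.of k)) (g : X ⟶ Y),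
        IsSeparated f → LocallyOfFiniteType f → QuasiCompact f → IsIntegral Y →
          Scheme.IsRegular Y → IsIntegral X → IsFinite g → UniversallyInjective g →
            Function.Surjective g.base → Scheme.HasResolution X := by
  by_contra hne
  apply h
  intro p hp hP
  exact absurd ⟨p, hp, hP⟩ hne

/-! ## `IsIntegral X` is load-bearing -/

/-- **At every prime, the consequent with `IsIntegral X` dropped fails.** Witness over `𝔽_p`:
`X = Spec 𝔽_p[ε]`, `X'' = Spec 𝔽_p`, `g = Spec (ε ↦ 0)` a closed immersion (finite, universally
injective, surjective onto the point), `X''` its own resolution, `Spec 𝔽_p[ε]` without resolution.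
[folklore] -/
theorem radicialBottom_false_without_isIntegral_at (p : ℕ) [Fact p.Prime] :
    ¬ ∀ (k : Type) [Field k] [CharP k p] (X X'' : Scheme.{0}) (f : X ⟶ Spec (.of k))
        (g : X'' ⟶ X), IsSeparated f → LocallyOfFiniteType f → QuasiCompact f → IsIntegral X'' →
          IsFinite g → UniversallyInjective g → Function.Surjective g.base →
            Scheme.HasResolution X'' → Scheme.HasResolution X := by
  intro h
  let g : Spec (.of (ZMod p)) ⟶ Spec (.of (DualNumber (ZMod p))) :=
    Spec.map (CommRingCat.ofHom (TrivSqZeroExt.fstHom (ZMod p) (ZMod p) (ZMod p)).toRingHom)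
  haveI : IsClosedImmersion g :=
    IsClosedImmersion.spec_of_surjective _ fun a => ⟨TrivSqZeroExt.inl a, by simp⟩
  haveI : Subsingleton ↥(Spec (.of (DualNumber (ZMod p)))) :=
    subsingleton_primeSpectrum_of_isUnit_or_isNilpotent TrivSqZeroExt.isUnit_or_isNilpotent
  have hsurj : Function.Surjective g.base := fun _ =>
    ⟨(⟨⊥, Ideal.isPrime_bot⟩ : PrimeSpectrum (ZMod p)), Subsingleton.elim _ _⟩
  exact not_hasResolution_Spec_dualNumber (ZMod p)
    (h (ZMod p) (Spec (.of (DualNumber (ZMod p)))) (Spec (.of (ZMod p)))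
      (Spec.map (CommRingCat.ofHom (algebraMap (ZMod p) (DualNumber (ZMod p))))) g
      inferInstance (locallyOfFiniteType_Spec_dualNumber (ZMod p)) inferInstance inferInstance
      inferInstance inferInstance hsurj (Scheme.isRegular_Spec (CommRingCat.of (ZMod p))).hasResolution)

/-- **Crux-shaped corollary.** With `IsIntegral X` dropped from its consequent, the crux
`∀ p prime, PICover_p → RadicialBottom_p⁻` is EQUIVALENT to `∀ p prime, ¬ PICover_p` — the
negation, at every prime, of the route's own rank-2 crux `Picover`. So every proof of the crux
uses `IsIntegral X` (or refutes the route). [folklore] -/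
theorem picoverToRadicialBottom_without_isIntegral_iff :
    (∀ p : ℕ, p.Prime →
      (∀ (k : Type) [Field k] [CharP k p] (Y X : Scheme.{0}) (f : Y ⟶ Spec (.of k)) (g : X ⟶ Y),
        IsSeparated f → LocallyOfFiniteType f → QuasiCompact f → IsIntegral Y →
          Scheme.IsRegular Y → IsIntegral X → IsFinite g → UniversallyInjective g →
            Function.Surjective g.base → Scheme.HasResolution X) →
      ∀ (k : Type) [Field k] [CharP k p] (X X'' : Scheme.{0}) (f : X ⟶ Spec (.of k))
        (g : X'' ⟶ X), IsSeparated f → LocallyOfFiniteType f → QuasiCompact f → IsIntegral X'' →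
          IsFinite g → UniversallyInjective g → Function.Surjective g.base →
            Scheme.HasResolution X'' → Scheme.HasResolution X) ↔
    ∀ p : ℕ, p.Prime →
      ¬ ∀ (k : Type) [Field k] [CharP k p] (Y X : Scheme.{0}) (f : Y ⟶ Spec (.of k)) (g : X ⟶ Y),
        IsSeparated f → LocallyOfFiniteType f → QuasiCompact f → IsIntegral Y →
          Scheme.IsRegular Y → IsIntegral X → IsFinite g → UniversallyInjective g →
            Function.Surjective g.base → Scheme.HasResolution X := by
  refine ⟨fun h p hp hP => ?_, fun h p hp hP => absurd hP (h p hp)⟩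
  haveI : Fact p.Prime := ⟨hp⟩
  exact radicialBottom_false_without_isIntegral_at p (h p hp hP)

/-! ## `HasResolution X''` is load-bearing modulo the summit -/

/-- **With `HasResolution X''` dropped, the consequent family over all primes IS the summit.**
Taking `g = 𝟙 X` shows the dropped family contains resolution of every integral separated
finite-type scheme over every field of positive characteristic, and the route's proved support item
`DescentReducedToIntegral_holds` (reduced → integral) upgrades that to `ResolutionOfSingularities`;
conversely the summit gives every instance. So without this hypothesis the crux would read
"PICover ⇒ summit". [folklore] -/
theorem radicialBottom_without_hasResolution_iff_summit :
    (∀ p : ℕ, p.Prime →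
      ∀ (k : Type) [Field k] [CharP k p] (X X'' : Scheme.{0}) (f : X ⟶ Spec (.of k))
        (g : X'' ⟶ X), IsSeparated f → LocallyOfFiniteType f → QuasiCompact f → IsIntegral X →
          IsIntegral X'' → IsFinite g → UniversallyInjective g → Function.Surjective g.base →
            Scheme.HasResolution X) ↔ _root_.ResolutionOfSingularities := by
  constructor
  · intro h p hp k _ _ X f hsep hft hqc hred
    refine DescentReducedToIntegral_holds k (fun Y fY hYsep hYft hYqc hY => ?_) X f hsep hft hqc hred
    exact h p hp k Y Y fY (𝟙 Y) hYsep hYft hYqc hY hY inferInstance inferInstance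
      (fun y => ⟨y, rfl⟩)
  · intro hS p hp k _ _ X X'' f g hsep hft hqc _ _ _ _ _
    exact hS p hp k X f hsep hft hqc inferInstance

/-! ## Only generic reducedness of `X` is load-bearing -/

/-- Given `IsIntegral X''` and surjectivity of `g`, the hypothesis `IsIntegral X` of the crux is
implied by `IsReduced X` (the continuous image of an irreducible space is irreducible).
[folklore] -/
theorem isIntegral_of_isReduced_of_surjective {X X'' : Scheme.{0}} (g : X'' ⟶ X)
    [IsIntegral X''] [IsReduced X] (hg : Function.Surjective g.base) : IsIntegral X := by
  haveI : IrreducibleSpace X := hg.irreducibleSpace g.base.hom.continuous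
  exact isIntegral_of_irreducibleSpace_of_isReduced X

end Summit.ResolutionOfSingularities.ResolutionOfSingularities.Theorems.PicoverToRadicialBottom.Negative

end
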